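import Mathlib
import Literature.Topology.FourManifolds.SmoothTriangulation
import HarnessLib

/-!
# DisconnectedTropicalData

Topic `Literature/Topology/FourManifolds`. Named literature fact(s) relocated by the gate from `Summits/SmoothPoincare4/SmoothPoincare4/Theorems/TropicalCollapse/Negative/TropicalCollapseFalseOfDisconnectedTropicalData.lean`
(accept-time relocation of `[cite]`d propositions written inline in a Summits proposal; human ruling 2026-08-15).

* `Literature.Topology.FourManifolds.DisconnectedTropicalData`
-/

namespace Literature.Topology.FourManifolds

open scoped BigOperators Topology Manifold Matrix
open Set Relation Geometry

/-- **`H` (negative-lemma protocol).** Some NON-connected `C^∞` 4-manifold carries a smooth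
triangulation, a vertex `v₀` and a positive integral tropical fan datum — verbatim the hypothesis
clauses of `TropicalCollapse`. True on paper (witness `S⁴ ⊔ S⁴`, `∂Δ⁵ ⊔ ∂Δ⁵`, calibration datum
`κ = 5` on the copy of `v₀`, closed sextic datum `κ = 6` on the other copy; exact machine check of
all typed clauses), not yet constructible in the tree (no formalised smooth triangulation of a
closed 4-manifold). [topic Topology/FourManifolds] [folklore] -/
def DisconnectedTropicalData : Prop :=
  ∃ (M : Type) (_ : TopologicalSpace M) (_ : T2Space M) (_ : SecondCountableTopology M)
    (_ : ChartedSpace (EuclideanSpace ℝ (Fin 4)) M) (_ : IsManifold (𝓡 4) (⊤ : ℕ∞) M),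
    ¬ ConnectedSpace M ∧ ∃ (N : ℕ) (K : Geometry.SimplicialComplex ℝ (EuclideanSpace ℝ (Fin N)))
      (h : K.space ≃ₜ M), Literature.Topology.FourManifolds.IsSmoothTriangulation 4 K h ∧
      ∃ v₀ : EuclideanSpace ℝ (Fin N), ({v₀} : Finset (EuclideanSpace ℝ (Fin N))) ∈ K.faces ∧
      ∃ x : EuclideanSpace ℝ (Fin N) → EuclideanSpace ℝ (Fin N) → (Fin 4 → ℝ),
        ((∀ a w i, ∃ z : ℤ, x a w i = z) ∧ (∀ a, x a a = 0) ∧ (∀ a : EuclideanSpace ℝ (Fin N), ({a} : Finset (EuclideanSpace ℝ (Fin N))) ∈ K.faces → a ≠ v₀ → (∀ σ ∈ K.faces, a ∈ σ → σ.card = 5 → ∀ f : Fin 4 → EuclideanSpace ℝ (Fin N), Function.Injective f → (∀ i, f i ∈ σ.erase a) → |Matrix.det (Matrix.of fun i j => x a (f i) j)| = 1) ∧ (∀ τ ∈ K.faces, ∀ τ' ∈ K.faces, a ∈ τ → a ∈ τ' → {y : Fin 4 → ℝ | ∃ c : EuclideanSpace ℝ (Fin N) → ℝ, (∀ w, 0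 ≤ c w) ∧ y = ∑ w ∈ (τ).erase a, c w • x a w} ∩ {y : Fin 4 → ℝ | ∃ c : EuclideanSpace ℝ (Fin N) → ℝ, (∀ w, 0 ≤ c w) ∧ y = ∑ w ∈ (τ').erase a, c w • x a w} = {y : Fin 4 → ℝ | ∃ c : EuclideanSpace ℝ (Fin N) → ℝ, (∀ w, 0 ≤ c w) ∧ y = ∑ w ∈ (τ ∩ τ').erase a, c w • x a w}) ∧ (⋃ τ ∈ {τ ∈ K.faces | a ∈ τ}, {y : Fin 4 → ℝ | ∃ c : EuclideanSpace ℝ (Fin N) → ℝ, (∀ w, 0 ≤ c w) ∧ y = ∑ w ∈ (τ).erase a, c w • x a w}) = Set.univ ∧ (∃ m : Finset (EuclideanSpace ℝ (Fin N)) → (Fin 4 → ℝ), ∀ σ ∈ K.faces, ∀ σ' ∈ K.faces, a ∈ σ → a ∈ σ' → σ.card = 5 → σ'.card = 5 → ∀ y ∈ {y : Fin 4 → ℝ | ∃ c : EuclideanSpace ℝ (Fin N) → ℝ, (∀ w, 0 ≤ c w) ∧ y = ∑ w ∈ (σ).erase a, c w • x a w}, (∑ i, m σ' i * y i ≤ ∑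 i, m σ i * y i) ∧ ((∑ i, m σ' i * y i = ∑ i, m σ i * y i) → y ∈ {y : Fin 4 → ℝ | ∃ c : EuclideanSpace ℝ (Fin N) → ℝ, (∀ w, 0 ≤ c w) ∧ y = ∑ w ∈ (σ').erase a, c w • x a w}))) ∧ (∀ ρ ∈ K.faces, ρ.card = 4 → ∀ σp ∈ K.faces, ∀ σm ∈ K.faces, σp.card = 5 → σm.card = 5 → ρ ⊆ σp → ρ ⊆ σm → σp ≠ σm → ∀ a ∈ ρ, ∀ b ∈ ρ, a ≠ b → a ≠ v₀ → b ≠ v₀ → ∀ ψp ψm : (Fin 4 → ℝ) →ᵃ[ℝ] (Fin 4 → ℝ), (∀ w ∈ σp, w ≠ v₀ → ψp (x a w) = x b w) → (v₀ ∈ σp → ψp.linear (x a v₀) = x b v₀) → (∀ w ∈ σm, w ≠ v₀ → ψm (x a w) = x b w) → (v₀ ∈ σm → ψm.linear (x a v₀) = x b v₀) → ∀ wp ∈ σp, wp ∉ ρ → ∀ g : Fin 3 → EuclideanSpace ℝ (Fin N), Function.Injective g → (∀ i, g i ∈ ρ.erase a) → ∃ κ : ℝ, 0 ≤ κ ∧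 ∀ y : Fin 4 → ℝ, ψp y = ψm (y + (κ * Matrix.det (Matrix.of ![y, x a (g 0), x a (g 1), x a (g 2)]) * Matrix.det (Matrix.of ![x a wp, x a (g 0), x a (g 1), x a (g 2)])) • x a b)))

end Literature.Topology.FourManifolds
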